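import Literature.RepresentationTheory.HeisenbergGroup.SchrodingerSymplecticGenerators
import HarnessLib

/-!
# Implementers of the elements of `Sp` preserving the modulation Lagrangian: Levi × unipotent block decomposition

Topic `RepresentationTheory/HeisenbergGroup`; namespace `Literature.RepresentationTheory.HeisenbergGroup`.  KERNEL ONLY:
theorems, no definition, no named fact, no `sorry`.

For the dot model `ρ = schrodingerSB ⟨·,·⟩ ψ` on `𝒮(F^ι)` (`F` a topological field with `2` invertible): an element
`g ∈ Sp(F^ι × F^ι, alt (polar ⟨·,·⟩))` which PRESERVES THE LAGRANGIAN `0 × F^ι` of modulations (`(g(0, y)).1 = 0`) is a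
product `m(a, d) n(b)` of a Levi element and a unipotent element of the Siegel parabolic
([Weil1964, n° 6]: `P(X)` is the semidirect product of its Levi and its unipotent radical; the blocks are read off as
`a x = (g(x,0)).1`, `d y = (g(0,y)).2`, `d (b x) = (g(x,0)).2`, the conditions `β(ax, dy) = β(x, y)` and `b` symmetric
being the symplecticity of `g`), hence is IMPLEMENTED on `ρ` by the explicit operator
`(O f)(u) = ψ(-½ ⟨u, (g(a⁻¹u, 0)).2⟩) f(a⁻¹ u)` (`leviEquivSB a ∘ unipotentEquivSB`, [Weil1964, n° 13];
[MoeglinVignerasWaldspurger1987, Chap. 2 II.6]) — **`exists_blockImplementer`**.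

Written for the cell `hodgecm-mathlib` (fan B, rung B-IV): in the symplectic chart adapted to an isotropic line of a
hermitian space, every element of the parabolic of the line preserves the modulation Lagrangian, and this operator gives
its action on the fibres of the Schrödinger model.  Nothing else is asserted.

## References
* [Weil1964] A. Weil, Acta Math. 111 (1964), n° 6 (the parabolic `P(X)`), n° 13 (the operators `d₀`, `t₀`).
* [MoeglinVignerasWaldspurger1987] C. Mœglin, M.-F. Vignéras, J.-L. Waldspurger, LNM 1291 (1987), Chap. 2 II.6.
-/

set_option autoImplicit false

noncomputable section

namespace Literature.RepresentationTheory.HeisenbergGroup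

open Literature.NumberTheory.Automorphic _root_.Matrix

section Block

variable {F : Type*} [Field F] [Invertible (2 : F)] [TopologicalSpace F] [IsTopologicalRing F]
  {ι : Type*} [Fintype ι] [DecidableEq ι]
  {ψ : AddChar F Circle} (hl : IsLocallyConstant (⇑ψ : F → Circle))
  (hb : ∀ y : ι → F, Continuous fun u : ι → F => dotProductBilin F F u y)

omit [Invertible (2 : F)] [TopologicalSpace F] [IsTopologicalRing F] in
/-- a vector orthogonal to everything for the dot product vanishes. [folklore] -/
private theorem eq_zero_of_forall_dotProduct_eq_zero {x : ι → F} (h : ∀ y : ι → F, x ⬝ᵥ y = 0) : x = 0 := by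
  funext i
  have := h (Pi.single i 1)
  rwa [dotProduct_single, mul_one] at this

omit [Invertible (2 : F)] [TopologicalSpace F] [IsTopologicalRing F] in
/-- … on the other side. [folklore] -/
private theorem eq_zero_of_forall_dotProduct_eq_zero' {y : ι → F} (h : ∀ x : ι → F, x ⬝ᵥ y = 0) : y = 0 := by
  funext i
  have := h (Pi.single i 1)
  rwa [single_dotProduct, one_mul] at this

/-- **Levi × unipotent decomposition and the implementer of an element of `Sp` preserving the modulation Lagrangian.**
For `g ∈ Sp(F^ι × F^ι)` with `(g(0,y)).1 = 0` for all `y` there are a linear automorphism `a` of `F^ι` with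
`(g(x,0)).1 = a x` and an operator `O` on `𝒮(F^ι)` IMPLEMENTING `ofSymplectic g` on the dot Schrödinger model, given by
`(O f)(u) = ψ(-½ ⟨u, (g(a⁻¹ u, 0)).2⟩) · f(a⁻¹ u)`. [cite: Weil1964, n° 13, p. 160] -/
theorem exists_blockImplementer (g : symplecticGroup (polar (dotProductBilin F F (m := ι))))
    (hg : ∀ y : ι → F, ((g : ((ι → F) × (ι → F)) ≃ₗ[F] ((ι → F) × (ι → F))) (0, y)).1 = 0) :
    ∃ (a : (ι → F) ≃ₗ[F] (ι → F)) (O : SchwartzBruhat (ι → F) ≃ₗ[ℂ] SchwartzBruhat (ι → F)),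
      (∀ x, ((g : ((ι → F) × (ι → F)) ≃ₗ[F] ((ι → F) × (ι → F))) (x, 0)).1 = a x) ∧
      Implements (schrodingerSB (dotProductBilin F F (m := ι)) ψ hl hb) (ofSymplectic _ g) O ∧
      ∀ (f : SchwartzBruhat (ι → F)) (u : ι → F), (O f : (ι → F) → ℂ) u =
        (ψ (-(⅟(2 : F) * (u ⬝ᵥ ((g : ((ι → F) × (ι → F)) ≃ₗ[F] ((ι → F) × (ι → F))) (a.symm u, 0)).2))) : ℂ) *
          (f : (ι → F) → ℂ) (a.symm u) := by
  set G : ((ι → F) × (ι → F)) ≃ₗ[F] ((ι → F) × (ι → F)) := (g : ((ι → F) × (ι → F)) ≃ₗ[F] ((ι → F) × (ι → F)))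
    with hG
  -- symplecticity, unfolded
  have hsymp : ∀ w w' : (ι → F) × (ι → F), (G w).1 ⬝ᵥ (G w').2 - (G w').1 ⬝ᵥ (G w).2 = w.1 ⬝ᵥ w'.2 - w'.1 ⬝ᵥ w.2 := by
    intro w w'
    have h := (mem_symplecticGroup _ _).1 g.2 w w'
    simpa only [polar_apply, dotProductBilin_apply_apply] using h
  -- the blocks
  let a₀ : (ι → F) →ₗ[F] (ι → F) := (LinearMap.fst F _ _) ∘ₗ G.toLinearMap ∘ₗ LinearMap.inl F _ _
  let c₀ : (ι → F) →ₗ[F] (ι → F) := (LinearMap.snd F _ _) ∘ₗ G.toLinearMap ∘ₗ LinearMap.inl F _ _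
  let d₀ : (ι → F) →ₗ[F] (ι → F) := (LinearMap.snd F _ _) ∘ₗ G.toLinearMap ∘ₗ LinearMap.inr F _ _
  have ha₀ : ∀ x, a₀ x = (G (x, 0)).1 := fun x => rfl
  have hc₀ : ∀ x, c₀ x = (G (x, 0)).2 := fun x => rfl
  have hd₀ : ∀ y, d₀ y = (G (0, y)).2 := fun y => rfl
  have hGx : ∀ x, G (x, 0) = (a₀ x, c₀ x) := fun x => rfl
  have hGy : ∀ y, G (0, y) = (0, d₀ y) := fun y => Prod.ext (hg y) rfl
  -- `β(a x, d y) = β(x, y)`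
  have had₀ : ∀ x y, a₀ x ⬝ᵥ d₀ y = x ⬝ᵥ y := by
    intro x y
    have h := hsymp (x, 0) (0, y)
    rw [hGx, hGy] at h
    simpa only [zero_dotProduct, dotProduct_zero, sub_zero] using h
  -- `β(a x, c x') = β(a x', c x)`
  have hac : ∀ x x', a₀ x ⬝ᵥ c₀ x' = a₀ x' ⬝ᵥ c₀ x := by
    intro x x'
    have h := hsymp (x, 0) (x', 0)
    rw [hGx, hGx] at h
    simpa only [dotProduct_zero, sub_self, sub_eq_zero] using h
  -- `a₀`, `d₀` are bijective
  have ha₀inj : Function.Injective a₀ := by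
    rw [← LinearMap.ker_eq_bot, LinearMap.ker_eq_bot']
    intro x hx
    refine eq_zero_of_forall_dotProduct_eq_zero fun y => ?_
    rw [← had₀, hx, zero_dotProduct]
  have hd₀inj : Function.Injective d₀ := by
    rw [← LinearMap.ker_eq_bot, LinearMap.ker_eq_bot']
    intro y hy
    refine eq_zero_of_forall_dotProduct_eq_zero' fun x => ?_
    rw [← had₀, hy, dotProduct_zero]
  let a : (ι → F) ≃ₗ[F] (ι → F) := LinearEquiv.ofBijective a₀
    ⟨ha₀inj, LinearMap.surjective_of_injective ha₀inj⟩
  let dd : (ι → F) ≃ₗ[F] (ι → F) := LinearEquiv.ofBijective d₀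
    ⟨hd₀inj, LinearMap.surjective_of_injective hd₀inj⟩
  have ha : ∀ x, a x = a₀ x := fun x => rfl
  have hdd : ∀ y, dd y = d₀ y := fun y => rfl
  have had : ∀ x y, dotProductBilin F F (a x) (dd y) = dotProductBilin F F x y := fun x y => by
    rw [dotProductBilin_apply_apply, dotProductBilin_apply_apply, ha, hdd, had₀]
  -- the unipotent block `b = d⁻¹ c`
  let b : (ι → F) →ₗ[F] (ι → F) := (dd.symm : (ι → F) →ₗ[F] (ι → F)) ∘ₗ c₀
  have hddb : ∀ x, dd (b x) = c₀ x := fun x => dd.apply_symm_apply (c₀ x)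
  have hβb : ∀ x x', x ⬝ᵥ b x' = a₀ x ⬝ᵥ c₀ x' := by
    intro x x'
    rw [← had₀ x (b x'), ← hdd, hddb]
  have hbsymm : ∀ x x', dotProductBilin F F x (b x') = dotProductBilin F F x' (b x) := by
    intro x x'
    rw [dotProductBilin_apply_apply, dotProductBilin_apply_apply, hβb, hβb, hac]
  -- the decomposition `g = m(a, d) n(b)`
  have hdec : g = leviSp (dotProductBilin F F (m := ι)) a dd had * unipotentSp (dotProductBilin F F (m := ι)) b hbsymm := by
    apply Subtype.ext
    refine LinearEquiv.ext fun w => ?_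
    obtain ⟨x, y⟩ := w
    rw [Subgroup.coe_mul, LinearEquiv.mul_apply, coe_unipotentSp, unipotentσ_apply, coe_leviSp_apply]
    show G (x, y) = (a x, dd (y + b x))
    have e : ((x, y) : (ι → F) × (ι → F)) = (x, 0) + (0, y) := by simp
    rw [e, map_add, hGx, hGy, map_add, hddb, ha, hdd, Prod.mk_add_mk, add_zero, add_comm (d₀ y)]
  -- continuity data
  have hacont : Continuous a := (a : (ι → F) →ₗ[F] (ι → F)).continuous_on_pi
  have hacont' : Continuous a.symm := (a.symm : (ι → F) →ₗ[F] (ι → F)).continuous_on_pi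
  have hbcont : Continuous b := b.continuous_on_pi
  have hqcont : Continuous fun x : ι → F => ⅟(2 : F) * dotProductBilin F F x (b x) := by
    simp only [dotProductBilin_apply_apply]
    exact continuous_const.mul (continuous_id.dotProduct hbcont)
  -- the implementer
  have hmem : (g, leviEquivSB a hacont hacont' *
      unipotentEquivSB ψ hl (fun x : ι → F => ⅟(2 : F) * dotProductBilin F F x (b x)) hqcont) ∈
      MpPsi (schrodingerSB (dotProductBilin F F (m := ι)) ψ hl hb) := by
    have h1 := levi_mem_MpPsi (dotProductBilin F F (m := ι)) ψ hl hb a dd had hacont hacont'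
    have h2 := unipotent_mem_MpPsi (dotProductBilin F F (m := ι)) ψ hl hb b hbsymm hqcont
    have h12 := (MpPsi _).mul_mem h1 h2
    rw [Prod.mk_mul_mk, ← hdec] at h12
    exact h12
  refine ⟨a, leviEquivSB a hacont hacont' *
      unipotentEquivSB ψ hl (fun x : ι → F => ⅟(2 : F) * dotProductBilin F F x (b x)) hqcont,
    fun x => (ha₀ x).symm, (mem_MpPsi _ _).1 hmem, fun f u => ?_⟩
  rw [LinearEquiv.mul_apply, coe_leviEquivSB, leviOp_apply, coe_unipotentEquivSB, unipotentOp_apply,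
    dotProductBilin_apply_apply, hβb, ← ha, LinearEquiv.apply_symm_apply, hc₀]

end Block

end Literature.RepresentationTheory.HeisenbergGroup

end
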